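import Mathlib
import HarnessLib
import Summits.NavierStokesRegularity.NavierStokesRegularity.Theorems.CompletionRelayChainRelayFrontStepIgnitionSigns

/-!
# `CompletionRelayChain` — crux `RelayFrontStep` (24850), LINE `window_v2`, stub `stub_ignition` (Phase II):
  the JOINT within-piece bootstrap (x₂ ceiling AND trigger floor) — blueprint §3, refined

`clock_piece_x2` (p614416) assumes the trigger floor `w_a ≤ u₁` on the whole piece. Along the flow that floor is itself a
consequence of the x₂-ceiling (`x₁ − x₂ ≥ m′ > 0 ⇒ u₁′ ≥ −ε₁`), so the two facts must be bootstrapped TOGETHER. This file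
proves `clock_piece_joint`: on a piece `[a,b] ⊆ [0,τ]` with `u(a) ≥ w_a`, `u ≤ w_b`, `x₂(a) ≤ X_a`, `x₁ + x₂ ≥ s₀`,
`x₂′ ≤ Λu² + ε`, `Λ(x₁ − x₂)u − ε₁ ≤ u′`, a crude lower Lipschitz bound `u′ ≥ −L_u`, and the numeric room conditions, BOTH
`x₂ ≤ X_b` and `u ≥ w_a − ε₁(t − a)` hold on the piece (two-member one-sided slack bootstrap, tree
`RelayFrontStep.bootstrap_family_oneSided_slack`). With it the pieces chain: the end state of piece `j` (u = w_{j+1} at the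
hitting time, x₂ ≤ X₂(j+1)) is the start state of piece `j+1`.

No definitions. HONEST FRAMING: elementary calculus; helper for the crux, no stub credit; nothing here is a statement about the
Navier–Stokes equations.
-/

noncomputable section

-- the summit-side namespace repeats a component by design (D-0017)
set_option linter.dupNamespace false

open Set MeasureTheory intervalIntegral

namespace Summit.NavierStokesRegularity.NavierStokesRegularity.Cruxes.RelayFrontStep.Window2

set_option maxHeartbeats 400000 in
/-- **Joint within-piece bootstrap** (x₂ ceiling + trigger floor). See the module docstring; `θ > 1` is the bootstrap
slack, `D := w_a − w_a′ > 0` the floor's room, `w″ := w_a′ − (θ−1)D > 0` the weak floor. [folklore] -/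
theorem clock_piece_joint {u x₁ x₂ : ℝ → ℝ} {τ a b Λ ε ε₁ Lu Mu s₀ Xa Xb m' wa wa' wb θ : ℝ} (hτ : 0 < τ)
    (hu : ContDiffOn ℝ 1 u (Icc 0 τ)) (hx₂ : ContDiffOn ℝ 1 x₂ (Icc 0 τ))
    (ha : 0 ≤ a) (hab : a ≤ b) (hb : b ≤ τ) (hΛ : 0 ≤ Λ) (hm : 0 < m') (hθ : 1 < θ) (hXb : 0 < Xb) (hε : 0 ≤ ε)
    (hε₁0 : 0 ≤ ε₁) (hLu : 0 ≤ Lu) (hwa' : wa' < wa) (hw'' : 0 < wa' - (θ - 1) * (wa - wa'))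
    (hua : wa ≤ u a) (hdrop : ε₁ * (b - a) ≤ wa - wa')
    (huhi : ∀ s ∈ Icc a b, u s ≤ wb) (hMu : ∀ s ∈ Icc a b, |u s| ≤ Mu)
    (hs₀ : ∀ s ∈ Icc a b, s₀ ≤ x₁ s + x₂ s) (hx₂a : x₂ a ≤ Xa)
    (hx₂' : ∀ s ∈ Icc a b, derivWithin x₂ (Icc 0 τ) s ≤ Λ * u s ^ 2 + ε)
    (hu' : ∀ s ∈ Icc a b, Λ * (x₁ s - x₂ s) * u s - ε₁ ≤ derivWithin u (Icc 0 τ) s)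
    (hu'crude : ∀ s ∈ Icc a b, -Lu ≤ derivWithin u (Icc 0 τ) s)
    (hm' : m' ≤ s₀ - 2 * (θ * Xb)) (hε₁ : ε₁ ≤ Λ * (s₀ - 2 * (θ * Xb) - m') * (wa' - (θ - 1) * (wa - wa')))
    (hroom : Xa + (wb ^ 2 - wa ^ 2) / (2 * m') + ε * (b - a) ≤ Xb) :
    (∀ t ∈ Icc a b, x₂ t ≤ Xb) ∧ (∀ t ∈ Icc a b, wa - ε₁ * (t - a) ≤ u t) := by
  have hsubI : Icc a b ⊆ Icc 0 τ := Icc_subset_Icc ha hb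
  set D : ℝ := wa - wa' with hD
  have hDpos : 0 < D := by rw [hD]; linarith
  have hwapos : 0 < wa := by nlinarith
  have hwb : wa ≤ wb := hua.trans (huhi a (left_mem_Icc.mpr hab))
  have hMu0 : 0 ≤ Mu := (abs_nonneg _).trans (hMu a (left_mem_Icc.mpr hab))
  -- uniform one-sided growth bounds for the two members
  have hgx : ∀ s ∈ Icc a b, ∀ t ∈ Icc a b, s ≤ t → x₂ t - x₂ s ≤ (Λ * Mu ^ 2 + ε) * (t - s) := by
    intro s hs t ht hst
    have h := increment_le_integral_of_derivWithin_le (g := fun _ => Λ * Mu ^ 2 + ε) hτ hx₂ continuousOn_const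
      (ha.trans hs.1) hst (ht.2.trans hb) (fun r hr => by
        have hrI : r ∈ Icc a b := ⟨hs.1.trans hr.1, hr.2.trans ht.2⟩
        have h1 := hx₂' r hrI
        have h2 : u r ^ 2 ≤ Mu ^ 2 := by
          rw [← sq_abs]; exact pow_le_pow_left₀ (abs_nonneg _) (hMu r hrI) 2
        nlinarith [mul_le_mul_of_nonneg_left h2 hΛ])
    rwa [intervalIntegral.integral_const, smul_eq_mul, mul_comm] at h
  have hgu : ∀ s ∈ Icc a b, ∀ t ∈ Icc a b, s ≤ t → u s - Lu * (t - s) ≤ u t := by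
    intro s hs t ht hst
    exact lower_linear_of_derivWithin_ge hτ hu (ha.trans hs.1) hst (ht.2.trans hb)
      (fun r hr => hu'crude r ⟨hs.1.trans hr.1, hr.2.trans ht.2⟩) t ⟨hst, le_rfl⟩
  -- the two-member family on shifted time: j = false ↦ x₂, j = true ↦ y := wa − u − ε₁ t' + D
  set L : ℝ := (Λ * Mu ^ 2 + ε) / Xb + Lu / D with hLdef
  have hL0 : 0 ≤ L := by positivity
  have key := Summit.NavierStokesRegularity.NavierStokesRegularity.Theorems.RelayFrontStep.bootstrap_family_oneSided_slack
    (ι := Bool) (u := fun j t' => if j then wa - u (a + t') - ε₁ * t' + D else x₂ (a + t'))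
    (p := fun j => if j then D else Xb) (ψ := fun _ => (1 : ℝ)) (τ := b - a) (L := L) (θ := θ) hθ
    (fun j => by cases j <;> simp <;> linarith) hL0 continuousOn_const (fun _ _ => one_pos)
    (fun j s hs t ht hst => by
      have hs' : a + s ∈ Icc a b := ⟨by linarith [hs.1], by linarith [hs.2]⟩
      have ht' : a + t ∈ Icc a b := ⟨by linarith [ht.1], by linarith [ht.2]⟩
      cases j with
      | false =>
        simp only [Bool.false_eq_true, ↓reduceIte]
        have h1 := hgx (a + s) hs' (a + t) ht' (by linarith)
        have hLX : Λ * Mu ^ 2 + ε ≤ L * Xb := by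
          have h3 : L * Xb = (Λ * Mu ^ 2 + ε) / Xb * Xb + Lu / D * Xb := by rw [hLdef]; ring
          have h4 : (Λ * Mu ^ 2 + ε) / Xb * Xb = Λ * Mu ^ 2 + ε := div_mul_cancel₀ _ hXb.ne'
          have h5 : 0 ≤ Lu / D * Xb := mul_nonneg (div_nonneg hLu hDpos.le) hXb.le
          linarith
        have h2 : (Λ * Mu ^ 2 + ε) * (t - s) ≤ L * Xb * (t - s) :=
          mul_le_mul_of_nonneg_right hLX (by linarith)
        have e : a + t - (a + s) = t - s := by ring
        rw [e] at h1
        linarith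
      | true =>
        simp only [↓reduceIte]
        have h1 := hgu (a + s) hs' (a + t) ht' (by linarith)
        have e : a + t - (a + s) = t - s := by ring
        rw [e] at h1
        have hLD : Lu ≤ L * D := by
          have h3 : L * D = (Λ * Mu ^ 2 + ε) / Xb * D + Lu / D * D := by rw [hLdef]; ring
          have h4 : Lu / D * D = Lu := div_mul_cancel₀ _ hDpos.ne'
          have h5 : 0 ≤ (Λ * Mu ^ 2 + ε) / Xb * D :=
            mul_nonneg (div_nonneg (by positivity) hXb.le) hDpos.le
          linarith
        have h2 : Lu * (t - s) ≤ L * D * (t - s) := mul_le_mul_of_nonneg_right hLD (by linarith)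
        have h3 : 0 ≤ ε₁ * (t - s) := mul_nonneg hε₁0 (by linarith)
        nlinarith [h1, h2, h3])
    (fun j => by
      cases j with
      | false =>
        simp only [Bool.false_eq_true, ↓reduceIte, add_zero, one_mul]
        have h1 : 0 ≤ (wb ^ 2 - wa ^ 2) / (2 * m') := by
          apply div_nonneg _ (by positivity); nlinarith [pow_le_pow_left₀ hwapos.le hwb 2]
        nlinarith [mul_nonneg hε (sub_nonneg.mpr hab)]
      | true =>
        simp only [↓reduceIte, add_zero, mul_zero, sub_zero, one_mul]
        linarith)
    (fun t' ht' hweak j => by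
      set x := a + t' with hxdef
      have hax : a ≤ x := by rw [hxdef]; linarith [ht'.1]
      have hxb : x ≤ b := by rw [hxdef]; linarith [ht'.2]
      -- weak hypotheses on [a, x]
      have hweakx : ∀ r ∈ Icc a x, x₂ r ≤ θ * Xb := by
        intro r hr
        have := hweak false (r - a) ⟨by linarith [hr.1], by linarith [hr.2]⟩
        simpa using this
      have hweaku : ∀ r ∈ Icc a x, wa' - (θ - 1) * (wa - wa') ≤ u r := by
        intro r hr
        have hw := hweak true (r - a) ⟨by linarith [hr.1], by linarith [hr.2]⟩
        simp only [↓reduceIte, mul_one] at hw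
        have e : a + (r - a) = r := by ring
        rw [e] at hw
        have hrb : r - a ≤ b - a := by linarith [hr.2]
        have h1 : ε₁ * (r - a) ≤ ε₁ * (b - a) := mul_le_mul_of_nonneg_left hrb hε₁0
        have h2 : θ * D = θ * wa - θ * wa' := by rw [hD]; ring
        have h3 : (θ - 1) * (wa - wa') = θ * wa - θ * wa' - wa + wa' := by ring
        rw [h3]
        linarith
      -- consequences on [a, x]: x₁ − x₂ ≥ m', u > 0, u' ≥ Λ m' u and u' ≥ −ε₁
      have hgrowu : ∀ r ∈ Icc a x, Λ * m' * u r ≤ derivWithin u (Icc 0 τ) r := by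
        intro r hr
        have hrI : r ∈ Icc a b := ⟨hr.1, hr.2.trans hxb⟩
        have h1 := hu' r hrI; have h2 := hs₀ r hrI; have h3 := hweakx r hr; have h4 := hweaku r hr
        have h5 : s₀ - 2 * (θ * Xb) ≤ x₁ r - x₂ r := by linarith
        have h6 : Λ * (s₀ - 2 * (θ * Xb) - m') * (wa' - (θ - 1) * (wa - wa')) ≤ Λ * (x₁ r - x₂ r - m') * u r := by
          have hA : 0 ≤ Λ * (s₀ - 2 * (θ * Xb) - m') := mul_nonneg hΛ (by linarith)
          calc Λ * (s₀ - 2 * (θ * Xb) - m') * (wa' - (θ - 1) * (wa - wa'))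
              ≤ Λ * (s₀ - 2 * (θ * Xb) - m') * u r := mul_le_mul_of_nonneg_left h4 hA
            _ ≤ Λ * (x₁ r - x₂ r - m') * u r := by
                apply mul_le_mul_of_nonneg_right _ (hw''.le.trans h4)
                exact mul_le_mul_of_nonneg_left (by linarith) hΛ
        have h7 : Λ * (x₁ r - x₂ r) * u r = Λ * m' * u r + Λ * (x₁ r - x₂ r - m') * u r := by ring
        linarith
      have hupos : ∀ r ∈ Icc a x, 0 ≤ u r := fun r hr => hw''.le.trans (hweaku r hr)
      have hu'eps : ∀ r ∈ Icc a x, -ε₁ ≤ derivWithin u (Icc 0 τ) r := by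
        intro r hr
        have h1 := hgrowu r hr
        have h2 : 0 ≤ Λ * m' * u r := mul_nonneg (mul_nonneg hΛ hm.le) (hupos r hr)
        linarith
      cases j with
      | true =>
        -- floor: u(x) ≥ u(a) − ε₁ (x − a) ≥ wa − ε₁ (x − a)
        show wa - u (a + t') - ε₁ * t' + D ≤ 1 * D
        have h1 := lower_linear_of_derivWithin_ge hτ hu ha hax (hxb.trans hb) hu'eps x ⟨hax, le_rfl⟩
        have e : x - a = t' := by rw [hxdef]; ring
        rw [e] at h1
        rw [← hxdef]
        linarith
      | false =>
        show x₂ (a + t') ≤ 1 * Xb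
        rw [one_mul, ← hxdef]
        have hint := clock_integral_le hτ hu ha hax (hxb.trans hb) hm hupos hgrowu
        have hcont : ContinuousOn (fun r => Λ * u r ^ 2 + ε) (Icc a x) :=
          (continuousOn_const.mul ((hu.continuousOn.mono (Icc_subset_Icc ha (hxb.trans hb))).pow 2)).add continuousOn_const
        have hinc := increment_le_integral_of_derivWithin_le hτ hx₂ hcont ha hax (hxb.trans hb)
          (fun r hr => hx₂' r ⟨hr.1, hr.2.trans hxb⟩)
        have hsplit : (∫ r in a..x, Λ * u r ^ 2 + ε) = (∫ r in a..x, Λ * u r ^ 2) + ε * (x - a) := by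
          have hi1 : IntervalIntegrable (fun r => Λ * u r ^ 2) volume a x :=
            ((continuousOn_const.mul ((hu.continuousOn.mono (Icc_subset_Icc ha (hxb.trans hb))).pow 2)).mono
              (by rw [uIcc_of_le hax])).intervalIntegrable
          rw [intervalIntegral.integral_add hi1 (by simp), intervalIntegral.integral_const, smul_eq_mul, mul_comm (x - a)]
        rw [hsplit] at hinc
        have hux : u x ^ 2 ≤ wb ^ 2 := pow_le_pow_left₀ (hupos x ⟨hax, le_rfl⟩) (huhi x ⟨hax, hxb⟩) 2
        have hua2 : wa ^ 2 ≤ u a ^ 2 := pow_le_pow_left₀ hwapos.le hua 2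
        have hq : (u x ^ 2 - u a ^ 2) / (2 * m') ≤ (wb ^ 2 - wa ^ 2) / (2 * m') :=
          div_le_div_of_nonneg_right (by linarith) (by positivity)
        have hεt : ε * (x - a) ≤ ε * (b - a) := mul_le_mul_of_nonneg_left (by linarith) hε
        linarith)
  constructor
  · intro t ht
    have := key false (t - a) ⟨by linarith [ht.1], by linarith [ht.2]⟩
    simpa using this
  · intro t ht
    have hw := key true (t - a) ⟨by linarith [ht.1], by linarith [ht.2]⟩
    simp only [↓reduceIte, one_mul] at hw
    have e : a + (t - a) = t := by ring
    rw [e] at hw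
    linarith

end Summit.NavierStokesRegularity.NavierStokesRegularity.Cruxes.RelayFrontStep.Window2
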